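import Summits.MatrixMultiplication.OmegaCensus.DominoShiftedForm
import HarnessLib

/-!
# Line (cyclic-quotient) identities of a domino shifted form and modular Farkas certificates

ω-census `pub-omega`, family (b3), seat pub-omega-group gen 19.  Framing: lottery ticket; floor = certified bounds/negative
ranges.  VALUE: the kernel form of a NEW necessary condition for the `ℤ_p²`-quotient column of the Dih-side mod-one
classification that needs no cyclotomic arithmetic; NOT progress on ω.

Setting: the shifted reduced form of a domino cube law triple (`DominoShiftedForm.domino_shifted_form_of_law`, ANY finite
abelian `A`): `X + Y` direct and `(X+Y) ⊔ (β + (Y−X)) ⊔ (γ + (X−Y)) = A ∖ {x₀}`.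

* `line_identity_of_shifted_form`: for a homomorphism `φ : A →+ ZMod q` and a half `η` (`η + η = 1`, so `q` odd), the
  fibre counts `F v = |X ∩ φ⁻¹(v + h)|`, `G v = |Y ∩ φ⁻¹(v + k)|` with `h = η·φβ`, `k = η·φγ` satisfy the NORMALISED line
  identity `Σ_v (F(τ−v) + F(v−τ) + F(τ+v))·G(v) + [s = τ] = |φ⁻¹(τ + h + k)|` for every `τ` (Radon identity with the two
  shifts translated away — possible in an odd cyclic quotient although not in `A`).
* `card_fibre_eq_of_surjective`: the right-hand side is a constant `K` when `φ` is onto.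
* `no_line_identity_of_certificate`: **modular Farkas certificate.**  If `z : ZMod q → ℕ` and a modulus `N` satisfy
  `Σ_τ z(τ)·(F(τ−v) + F(v−τ) + F(τ+v)) ≡ 0 (mod N)` for every `v` and `Σ_τ z(τ) ≢ q·z(s) (mod N)`, then NO `G, K` satisfy the
  identity with that `F, s`.  (Proof: summing the identity gives `q·K = 3·|F|·|G| + 1`; pairing it with `z` gives
  `z(s) ≡ K·Σz` and `3|F|·Σz ≡ 0`, whence `q·z(s) ≡ Σz`.)  The certificate does not mention `G` or `K`, so ONE certificate for
  the image multiset `F` excludes every order `|A|` at once.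
These are the two structural inputs of the `ℤ₅ × ℤ₅` domino cell theorems (`DominoZ5Z5Cells*.lean`); the finite tables of
certificates live in `DominoZ5LineTables.lean`.
-/

namespace Summit.MatrixMultiplication.OmegaCensus

open Finset

/-! ## Fibres of a surjective homomorphism -/

section Fibre

variable {A B : Type*} [AddCommGroup A] [DecidableEq A] [Fintype A] [AddCommGroup B] [DecidableEq B]

/-- All fibres of a surjective homomorphism of finite abelian groups have the same size. [folklore] -/
theorem card_fibre_eq_of_surjective (φ : A →+ B) (hφ : Function.Surjective φ) (t t' : B) :
    (univ.filter fun a : A => φ a = t).card = (univ.filter fun a : A => φ a = t').card := by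
  obtain ⟨a₁, ha₁⟩ := hφ (t' - t)
  have himg : (univ.filter fun a : A => φ a = t).image (fun a => a + a₁) = univ.filter fun a : A => φ a = t' := by
    ext b
    simp only [mem_image, mem_filter, mem_univ, true_and]
    constructor
    · rintro ⟨a, ha, rfl⟩
      rw [map_add, ha, ha₁, add_sub_cancel]
    · intro hb
      refine ⟨b - a₁, ?_, sub_add_cancel b a₁⟩
      rw [map_sub, hb, ha₁, sub_sub_cancel]
  rw [← himg, card_image_of_injective _ (add_left_injective a₁)]

omit [Fintype A] [DecidableEq A] in
/-- Fibre counts push forward along a second homomorphism: `|X ∩ (πφ)⁻¹(c)| = Σ_{π u = c} |X ∩ φ⁻¹(u)|`. [folklore] -/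
theorem card_fibre_comp_eq_sum {C : Type*} [AddCommGroup C] [DecidableEq C] [Fintype B] (φ : A →+ B) (π : B →+ C)
    (X : Finset A)
    (c : C) : (X.filter fun a : A => π (φ a) = c).card =
      ∑ u ∈ univ.filter (fun u : B => π u = c), (X.filter fun a : A => φ a = u).card := by
  rw [card_eq_sum_card_fiberwise (f := fun a : A => φ a) (s := X.filter fun a : A => π (φ a) = c)
    (t := univ.filter fun u : B => π u = c) (fun a ha => by
      have ha' := (mem_filter.1 (mem_coe.1 ha)).2
      exact mem_coe.2 (mem_filter.2 ⟨mem_univ _, ha'⟩))]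
  refine sum_congr rfl fun u hu => ?_
  have hu' := (mem_filter.1 hu).2
  congr 1
  ext a
  simp only [mem_filter]
  constructor
  · rintro ⟨⟨ha, -⟩, hu''⟩; exact ⟨ha, hu''⟩
  · rintro ⟨ha, hu''⟩; exact ⟨⟨ha, by rw [hu'', hu']⟩, hu''⟩

end Fibre

/-! ## The normalised line identity -/

section Line

variable {A : Type*} [AddCommGroup A] [DecidableEq A] [Fintype A] {q : ℕ} [NeZero q]

/-- **Normalised line identity of a shifted form.**  Data `X, Y, β, γ, x₀` as in `domino_shifted_form_of_law`, a homomorphism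
`φ : A →+ ZMod q` and `η` with `η + η = 1`.  With `h = η·φβ`, `k = η·φγ`, `F v = |X ∩ φ⁻¹(v + h)|`, `G v = |Y ∩ φ⁻¹(v + k)|`:
`Σ_v (F(τ−v) + F(v−τ) + F(τ+v))·G v + [φ x₀ − h − k = τ] = |φ⁻¹(τ + h + k)|`. [folklore] -/
theorem line_identity_of_shifted_form (φ : A →+ ZMod q) (η : ZMod q) (hη : η + η = 1) {X Y : Finset A} {β γ x₀ : A}
    (hinj : Set.InjOn (fun p : A × A => p.1 + p.2) ↑(X ×ˢ Y))
    (hPQ : Disjoint ((X ×ˢ Y).image fun p : A × A => p.1 + p.2)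
      (((Y ×ˢ X).image fun p : A × A => p.1 - p.2).image fun z => z + β))
    (hPR : Disjoint ((X ×ˢ Y).image fun p : A × A => p.1 + p.2)
      (((X ×ˢ Y).image fun p : A × A => p.1 - p.2).image fun z => z + γ))
    (hQR : Disjoint (((Y ×ˢ X).image fun p : A × A => p.1 - p.2).image fun z => z + β)
      (((X ×ˢ Y).image fun p : A × A => p.1 - p.2).image fun z => z + γ))
    (hcover : ((X ×ˢ Y).image fun p : A × A => p.1 + p.2) ∪
      (((Y ×ˢ X).image fun p : A × A => p.1 - p.2).image fun z => z + β) ∪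
      (((X ×ˢ Y).image fun p : A × A => p.1 - p.2).image fun z => z + γ) = univ.erase x₀) (τ : ZMod q) :
    (∑ v : ZMod q, ((X.filter fun a => φ a = (τ - v) + η * φ β).card + (X.filter fun a => φ a = (v - τ) + η * φ β).card +
        (X.filter fun a => φ a = (τ + v) + η * φ β).card) * (Y.filter fun a => φ a = v + η * φ γ).card) +
      (if φ x₀ - η * φ β - η * φ γ = τ then 1 else 0) =
      (univ.filter fun a : A => φ a = τ + η * φ β + η * φ γ).card := by
  set h := η * φ β with hh
  set k := η * φ γ with hk
  have hβ : φ β = h + h := by rw [hh, ← add_mul, hη, one_mul]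
  have hγ : φ γ = k + k := by rw [hk, ← add_mul, hη, one_mul]
  have key := radon_identity_shifted φ hinj hPQ hPR hQR hcover (τ + h + k)
  rw [← key]
  have e1 : ∀ v : ZMod q, τ + h + k - (v + k) = τ - v + h := fun v => by abel
  have e2 : ∀ v : ZMod q, v + k - (τ + h + k - φ β) = v - τ + h := fun v => by rw [hβ]; abel
  have e3 : ∀ v : ZMod q, τ + h + k - φ γ + (v + k) = τ + v + h := fun v => by rw [hγ]; abel
  have e4 : (φ x₀ - h - k = τ) ↔ (φ x₀ = τ + h + k) :=
    ⟨fun e => by rw [← e]; abel, fun e => by rw [e]; abel⟩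
  congr 1
  · refine Fintype.sum_equiv (Equiv.addRight k) _ _ fun v => ?_
    simp only [Equiv.coe_addRight, e1, e2, e3]
  · simp only [e4]

end Line

/-! ## Modular Farkas certificates -/

section Certificate

variable {q : ℕ} [NeZero q]

/-- Row sums of the line matrix: `Σ_v (F(τ−v) + F(v−τ) + F(τ+v)) = 3·Σ F`. [folklore] -/
theorem line_row_sum (F : ZMod q → ℕ) (τ : ZMod q) :
    ∑ v : ZMod q, (F (τ - v) + F (v - τ) + F (τ + v)) = 3 * ∑ v : ZMod q, F v := by
  rw [sum_add_distrib, sum_add_distrib]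
  rw [Fintype.sum_equiv (Equiv.subLeft τ) (fun v => F (τ - v)) F fun v => rfl,
    Fintype.sum_equiv (Equiv.subRight τ) (fun v => F (v - τ)) F fun v => rfl,
    Fintype.sum_equiv (Equiv.addLeft τ) (fun v => F (τ + v)) F fun v => rfl]
  ring

/-- Column sums of the line matrix: `Σ_τ (F(τ−v) + F(v−τ) + F(τ+v)) = 3·Σ F`. [folklore] -/
theorem line_col_sum (F : ZMod q → ℕ) (v : ZMod q) :
    ∑ τ : ZMod q, (F (τ - v) + F (v - τ) + F (τ + v)) = 3 * ∑ τ : ZMod q, F τ := by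
  rw [sum_add_distrib, sum_add_distrib]
  rw [Fintype.sum_equiv (Equiv.subRight v) (fun τ => F (τ - v)) F fun τ => rfl,
    Fintype.sum_equiv (Equiv.subLeft v) (fun τ => F (v - τ)) F fun τ => rfl,
    Fintype.sum_equiv (Equiv.addRight v) (fun τ => F (τ + v)) F fun τ => rfl]
  ring

/-- **No line identity under a modular Farkas certificate.**  If `Σ_τ z(τ)·(F(τ−v)+F(v−τ)+F(τ+v)) ≡ 0 (mod N)` for all `v`
and `Σ_τ z(τ) ≢ q·z(s) (mod N)`, then no `G : ZMod q → ℕ` and constant `K` satisfy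
`Σ_v (F(τ−v)+F(v−τ)+F(τ+v))·G(v) + [s = τ] = K` for all `τ`. [folklore] -/
theorem no_line_identity_of_certificate (F G : ZMod q → ℕ) (s : ZMod q) (K : ℕ)
    (hid : ∀ τ : ZMod q, (∑ v : ZMod q, (F (τ - v) + F (v - τ) + F (τ + v)) * G v) + (if s = τ then 1 else 0) = K)
    (N : ℕ) (z : ZMod q → ℕ)
    (hz : ∀ v : ZMod q, ((∑ τ : ZMod q, z τ * (F (τ - v) + F (v - τ) + F (τ + v)) : ℕ) : ZMod N) = 0)
    (hs : ((∑ τ : ZMod q, z τ : ℕ) : ZMod N) ≠ ((q * z s : ℕ) : ZMod N)) : False := by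
  set d := ∑ v : ZMod q, F v with hd
  set e := ∑ v : ZMod q, G v with he
  -- (1) summing the identity over `τ`: `3de + 1 = qK`
  have htot : 3 * d * e + 1 = q * K := by
    have h1 := congrArg (fun f : ZMod q → ℕ => ∑ τ, f τ) (funext hid)
    simp only [sum_add_distrib, sum_const, card_univ, ZMod.card, smul_eq_mul] at h1
    rw [sum_ite_eq, if_pos (mem_univ _), sum_comm] at h1
    have h2 : ∑ y : ZMod q, ∑ x : ZMod q, (F (x - y) + F (y - x) + F (x + y)) * G y = 3 * d * e := by
      rw [he, mul_sum]
      refine sum_congr rfl fun y _ => ?_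
      rw [← sum_mul, line_col_sum, hd]
    omega
  -- (2) pairing with `z`: `z s ≡ K Σz (mod N)`
  have hpair : ((z s : ℕ) : ZMod N) = ((K * ∑ τ : ZMod q, z τ : ℕ) : ZMod N) := by
    have h1 : ∑ τ : ZMod q, z τ * ((∑ v : ZMod q, (F (τ - v) + F (v - τ) + F (τ + v)) * G v) +
        (if s = τ then 1 else 0)) = ∑ τ : ZMod q, z τ * K := sum_congr rfl fun τ _ => by rw [hid τ]
    simp only [mul_add, sum_add_distrib, mul_ite, mul_one, mul_zero, sum_ite_eq, mem_univ, if_true] at h1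
    have h2 : ((∑ τ : ZMod q, z τ * ∑ v : ZMod q, (F (τ - v) + F (v - τ) + F (τ + v)) * G v : ℕ) : ZMod N) = 0 := by
      have : ∑ τ : ZMod q, z τ * ∑ v : ZMod q, (F (τ - v) + F (v - τ) + F (τ + v)) * G v =
          ∑ v : ZMod q, G v * ∑ τ : ZMod q, z τ * (F (τ - v) + F (v - τ) + F (τ + v)) := by
        simp_rw [mul_sum]
        rw [sum_comm]
        exact sum_congr rfl fun v _ => sum_congr rfl fun τ _ => by ring
      rw [this, Nat.cast_sum]
      refine sum_eq_zero fun v _ => ?_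
      rw [Nat.cast_mul, hz v, mul_zero]
    have h1c := congrArg (Nat.cast : ℕ → ZMod N) h1
    rw [Nat.cast_add, h2, zero_add] at h1c
    rw [h1c, mul_sum]
    exact congrArg _ (sum_congr rfl fun τ _ => mul_comm _ _)
  -- (3) `3d Σz ≡ 0 (mod N)`
  have h3d : ((3 * d * ∑ τ : ZMod q, z τ : ℕ) : ZMod N) = 0 := by
    have h1 : ((∑ v : ZMod q, ∑ τ : ZMod q, z τ * (F (τ - v) + F (v - τ) + F (τ + v)) : ℕ) : ZMod N) = 0 := by
      push_cast
      refine sum_eq_zero fun v _ => ?_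
      have := hz v
      push_cast at this
      exact this
    have h2 : ∑ v : ZMod q, ∑ τ : ZMod q, z τ * (F (τ - v) + F (v - τ) + F (τ + v)) = 3 * d * ∑ τ : ZMod q, z τ := by
      rw [sum_comm, mul_sum]
      refine sum_congr rfl fun τ _ => ?_
      rw [← mul_sum, line_row_sum, hd]; ring
    rw [h2] at h1
    exact h1
  -- (4) `q z s ≡ qK Σz = (3de+1) Σz ≡ Σz`
  apply hs
  have : ((q * z s : ℕ) : ZMod N) = (((3 * d * e + 1) * ∑ τ : ZMod q, z τ : ℕ) : ZMod N) := by
    rw [htot]; push_cast; rw [hpair]; push_cast; ring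
  rw [this]; push_cast
  have h3 : ((3 : ZMod N) * d * ∑ τ : ZMod q, (z τ : ZMod N)) = 0 := by exact_mod_cast h3d
  linear_combination -(e : ZMod N) * h3

end Certificate

end Summit.MatrixMultiplication.OmegaCensus
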